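import Mathlib.Analysis.Calculus.ContDiff.Bounds
import Mathlib.Analysis.Calculus.IteratedDeriv.Lemmas
import Mathlib.Algebra.BigOperators.Ring.Finset
import HarnessLib

/-!
# Leibniz bounds for iterated derivatives of a product of functions of one variable, with geometric derivative bounds

Topic `Literature/Analysis/Calculus`; the one-variable (line-restriction) form of Mathlib's
`norm_iteratedFDeriv_mul_le`, and its consequence for factors whose derivatives grow GEOMETRICALLY in the order: if
`‖f^{(i)}‖ ≤ A ρⁱ` and `‖g^{(i)}‖ ≤ B ρⁱ` for `i ≤ N` then `‖(fg)^{(N)}‖ ≤ 2ᴺ A B ρᴺ`.  This is how symbol estimates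
along a line are multiplied: the single-scale sector symbol of Benfatto–Giuliani–Mastropietro 2006 (Lemma 2.2) obeys
`‖∂ₛⁱ σ(q + s w)‖ ≤ 4ⁿBᵢ ρ(w)ⁱ` with the direction cost `ρ(w)`, and so does every smooth sector cutoff, hence so do the
two-sector products `F̃_ω F̃_{ω'} σ` that form the entries of the sectorised covariances.

* `norm_iteratedDeriv_mul_le` — `‖(fg)^{(n)}(x)‖ ≤ Σᵢ C(n,i) ‖f^{(i)}(x)‖ ‖g^{(n-i)}(x)‖` for `f, g : ℝ → 𝔸` of class `Cⁿ`
  (`𝔸` a normed algebra);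
* **`norm_iteratedDeriv_mul_le_of_geometric`** — geometric bounds multiply: `≤ 2ⁿ A B ρⁿ`;
* `norm_iteratedDeriv_const_mul_le`, `norm_iteratedDeriv_mul_le_of_geometric_three` — a constant factor, and three
  factors (`≤ 4ⁿ A B C ρⁿ`).

Everything is proved; no definitions, no named facts. [folklore]

## Sources

G. Benfatto, A. Giuliani, V. Mastropietro, Ann. Henri Poincaré 7 (2006) 809–898, §2.7 (2.66)–(2.71a)
(`BenfattoGiulianiMastropietro2006`).  Routine calculus ("folklore"); Mathlib `norm_iteratedFDeriv_mul_le`.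
-/

noncomputable section

open Finset

namespace Literature.Analysis.Calculus

variable {𝔸 : Type*} [NormedRing 𝔸] [NormedAlgebra ℝ 𝔸]

/-- **Leibniz bound in one variable**: `‖(fg)^{(n)}(x)‖ ≤ Σᵢ C(n,i) ‖f^{(i)}(x)‖ ‖g^{(n-i)}(x)‖`. [folklore] -/
theorem norm_iteratedDeriv_mul_le {f g : ℝ → 𝔸} {n : ℕ} (hf : ContDiff ℝ n f) (hg : ContDiff ℝ n g) (x : ℝ) :
    ‖iteratedDeriv n (fun y => f y * g y) x‖ ≤
      ∑ i ∈ range (n + 1), (n.choose i : ℝ) * ‖iteratedDeriv i f x‖ * ‖iteratedDeriv (n - i) g x‖ := by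
  have h := norm_iteratedFDeriv_mul_le (𝕜 := ℝ) hf hg x (n := n) le_rfl
  simpa only [norm_iteratedFDeriv_eq_norm_iteratedDeriv] using h

/-- **Geometric derivative bounds multiply**: if `‖f^{(i)}(x)‖ ≤ A ρⁱ` and `‖g^{(i)}(x)‖ ≤ B ρⁱ` for all `i ≤ n`
(`ρ ≥ 0`), then `‖(fg)^{(n)}(x)‖ ≤ 2ⁿ A B ρⁿ`. [folklore] -/
theorem norm_iteratedDeriv_mul_le_of_geometric {f g : ℝ → 𝔸} {n : ℕ} (hf : ContDiff ℝ n f) (hg : ContDiff ℝ n g)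
    (x : ℝ) {A B ρ : ℝ} (hρ : 0 ≤ ρ) (hA : ∀ i ≤ n, ‖iteratedDeriv i f x‖ ≤ A * ρ ^ i)
    (hB : ∀ i ≤ n, ‖iteratedDeriv i g x‖ ≤ B * ρ ^ i) :
    ‖iteratedDeriv n (fun y => f y * g y) x‖ ≤ 2 ^ n * A * B * ρ ^ n := by
  have hA0 : 0 ≤ A := by
    have h := hA 0 (Nat.zero_le n); rw [pow_zero, mul_one] at h; exact (norm_nonneg _).trans h
  have hB0 : 0 ≤ B := by
    have h := hB 0 (Nat.zero_le n); rw [pow_zero, mul_one] at h; exact (norm_nonneg _).trans h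
  refine (norm_iteratedDeriv_mul_le hf hg x).trans ?_
  calc ∑ i ∈ range (n + 1), (n.choose i : ℝ) * ‖iteratedDeriv i f x‖ * ‖iteratedDeriv (n - i) g x‖
      ≤ ∑ i ∈ range (n + 1), (n.choose i : ℝ) * (A * B * ρ ^ n) := by
        refine sum_le_sum fun i hi => ?_
        have hin : i ≤ n := Nat.lt_succ_iff.1 (mem_range.1 hi)
        rw [mul_assoc]
        refine mul_le_mul_of_nonneg_left ?_ (Nat.cast_nonneg _)
        calc ‖iteratedDeriv i f x‖ * ‖iteratedDeriv (n - i) g x‖ ≤ (A * ρ ^ i) * (B * ρ ^ (n - i)) :=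
            mul_le_mul (hA i hin) (hB (n - i) (Nat.sub_le n i)) (norm_nonneg _) (mul_nonneg hA0 (pow_nonneg hρ i))
          _ = A * B * ρ ^ n := by
            rw [show A * ρ ^ i * (B * ρ ^ (n - i)) = A * B * (ρ ^ i * ρ ^ (n - i)) by ring, ← pow_add,
              Nat.add_sub_cancel' hin]
    _ = 2 ^ n * A * B * ρ ^ n := by
        rw [← sum_mul]
        have h : ∑ i ∈ range (n + 1), (n.choose i : ℝ) = 2 ^ n := by
          have := Nat.sum_range_choose n
          exact_mod_cast this
        rw [h]; ring

/-- A constant factor: `‖(c f)^{(n)}(x)‖ ≤ ‖c‖ ‖f^{(n)}(x)‖`. [folklore] -/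
theorem norm_iteratedDeriv_const_mul_le {f : ℝ → 𝔸} {n : ℕ} (hf : ContDiff ℝ n f) (c : 𝔸) (x : ℝ) :
    ‖iteratedDeriv n (fun y => c * f y) x‖ ≤ ‖c‖ * ‖iteratedDeriv n f x‖ := by
  rw [iteratedDeriv_const_mul c (hf.contDiffAt (x := x))]
  exact norm_mul_le _ _

/-- **Three factors**: if `‖f^{(i)}‖ ≤ Aρⁱ`, `‖g^{(i)}‖ ≤ Bρⁱ`, `‖h^{(i)}‖ ≤ Cρⁱ` for `i ≤ n` then
`‖(fgh)^{(n)}(x)‖ ≤ 4ⁿ A B C ρⁿ`. [folklore] -/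
theorem norm_iteratedDeriv_mul_le_of_geometric_three {f g h : ℝ → 𝔸} {n : ℕ} (hf : ContDiff ℝ n f)
    (hg : ContDiff ℝ n g) (hh : ContDiff ℝ n h) (x : ℝ) {A B C ρ : ℝ} (hρ : 0 ≤ ρ)
    (hA : ∀ i ≤ n, ∀ y, ‖iteratedDeriv i f y‖ ≤ A * ρ ^ i) (hB : ∀ i ≤ n, ∀ y, ‖iteratedDeriv i g y‖ ≤ B * ρ ^ i)
    (hC : ∀ i ≤ n, ∀ y, ‖iteratedDeriv i h y‖ ≤ C * ρ ^ i) :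
    ‖iteratedDeriv n (fun y => f y * g y * h y) x‖ ≤ 4 ^ n * A * B * C * ρ ^ n := by
  -- first `fg`, at all orders `i ≤ n`
  have hfg : ∀ i ≤ n, ∀ y, ‖iteratedDeriv i (fun y => f y * g y) y‖ ≤ (2 ^ n * A * B) * ρ ^ i := by
    intro i hi y
    have h1 := norm_iteratedDeriv_mul_le_of_geometric (hf.of_le (by exact_mod_cast hi)) (hg.of_le (by exact_mod_cast hi))
      y hρ (fun j hj => hA j (hj.trans hi) y) (fun j hj => hB j (hj.trans hi) y)
    refine h1.trans ?_
    have hA0 : 0 ≤ A := by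
      have h := hA 0 (Nat.zero_le n) y; rw [pow_zero, mul_one] at h; exact (norm_nonneg _).trans h
    have hB0 : 0 ≤ B := by
      have h := hB 0 (Nat.zero_le n) y; rw [pow_zero, mul_one] at h; exact (norm_nonneg _).trans h
    have h2 : (2 : ℝ) ^ i ≤ 2 ^ n := pow_le_pow_right₀ (by norm_num) hi
    have := mul_le_mul_of_nonneg_right h2 (mul_nonneg (mul_nonneg hA0 hB0) (pow_nonneg hρ i))
    nlinarith [this]
  have h := norm_iteratedDeriv_mul_le_of_geometric (hf.mul hg) hh x hρ (fun i hi => hfg i hi x) (fun i hi => hC i hi x)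
  refine h.trans (le_of_eq ?_)
  rw [show (4 : ℝ) ^ n = 2 ^ n * 2 ^ n by rw [← mul_pow]; norm_num]
  ring

end Literature.Analysis.Calculus
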